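import Summits.HodgeConjecture.HodgeConjecture.Theses.HolomorphicityRate
import Literature.Geometry.Kaehler.NearlyHolomorphicCycleSupport

/-!
# `NonHodgeRateAtMostOne` (stmt-HodgeConjecture-2738) · Negative · the filed R3 is not reparametrisation-proof

Negative-side knowledge for the support item `HolomorphicityRate.NonHodgeRateAtMostOne` (R3 of the
card *holomorphicity-rate-threshold*: "a rational class NOT of type `(p,p)` admits nearly
holomorphic cycle supports of defect `≤ t_k`, `t_k·k → 0`, along a ray `m•c + a_k•hp` with
`a_k ≤ C·k^p` only finitely often").

* `NonHodgeRayAtRate` — the hypothesis `H` of the negative lemma: on SOME smooth projective `X`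
  there is a rational class `c` not of type `(p,p)` (`p ≤ n`) whose ray `m•c + j•hp` (`hp` rational
  algebraic, `m ≥ 1`) carries, for all large `j`, a nearly holomorphic cycle support of defect
  `≤ C'·j^{-e}` for an exponent with `e·p > 1`.  WHY IT HOLDS (not constructible in the tree today):
  take `X` with `h^{2,0}(X) ≠ 0` and `n ≥ 4` (an abelian fourfold), `3 ≤ p ≤ n - 1`, `α ∈ H²(X,ℚ)` with
  `α^{2,0} ≠ 0`, `h` the hyperplane class, `c := α•h^{p-1}` (rational; its `(p+1,p-1)`-component
  `α^{2,0}•h^{p-1}` is non-zero by hard Lefschetz, [VoisinHodgeI2002, Thm. 6.25 with Prop. 6.11 / the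
  bigraded Lefschetz decomposition], so `c` is not `(p,p)`), `hp := h^p`, `Y ⊂ X` a smooth complete
  intersection of `p - 1` hyperplanes (`[Y] = h^{p-1}`, `dim Y = n - p + 1 ≥ 2`), `E → Y` the `C^∞` line
  bundle with `c₁(E) = m•α|_Y`, `L = 𝒪(1)|_Y`.  Auroux's extension of Donaldson's theorem
  [Auroux1997, Thm. 2 and Cor. 1; Donaldson1996, Thm. 5] gives for all large `j` asymptotically
  holomorphic, uniformly transverse `C^∞` sections of `E ⊗ L^j`; their zero sets `Z_j ⊂ Y` are connected
  real-codimension-`2` submanifolds of `Y` [Auroux1997, Prop. 2 = Lefschetz hyperplane property;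
  Donaldson1996, Prop. 39] with `J(TZ_j)` within `O(j^{-1/2})` of `TZ_j` [Auroux1997, Prop. 1], Poincaré
  dual in `Y` to `m•α|_Y + j•h|_Y`, hence (Gysin / projection formula) carrying in `X` the class
  `(m•α + j•h)•h^{p-1} = m•c + j•hp`, which dies on `X ∖ Z_j` (Thom class); since `TZ_j ⊂ TY` and `TY`
  is `J`-stable, the `J`-defect of `Z_j` in `X` is that in `Y`, `≤ C'·j^{-1/2}`; `Sg = ∅`.  So `H` holds
  with `e = 1/2`, `p = 3` (`e·p = 3/2 > 1`).  (With the rate-`1` representatives claimed by the route's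
  own item `UniversalRateOne` run on `Y`, already `p = 2` works: `e = 1`.)
* `NonHodgeRateAtMostOne_false_of_NonHodgeRayAtRate` : `H → ¬ NonHodgeRateAtMostOne` — pure
  reindexing: feed R3 the subsequence `k ↦ j = k^p` (`a_k := k^p ≤ 1·k^p` is inside the budget) with
  `t_k := C'·(k^p)^{-e}`; then `t_k·k = C'·k^{1-ep} → 0` because `e·p > 1`, while the supports exist
  for all large `k`.  The budget `a_k ≤ C·k^p` together with a threshold tied to the INDEX `k`
  (`t_k·k → 0`) rather than to the degree `a_k` or to the mass `∼ k^p` is what breaks; the companion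
  file `Theorems/HolomorphicityRateNonHodgeRateAtMostOne.lean` shows that with E2's threshold
  `t_k·k^p → 0` the statement follows from `ThresholdForcesHodgeType`, and that the filed statement
  survives for `p ≤ 1`.

Prover seat prover-pitem-stmt-HodgeConjecture-2738-0, 2026-08-16.  The construction `H` is recorded
as a `def` (a construction item for the gate), never asserted.
-/

namespace Summit.HodgeConjecture.HodgeConjecture.Theses.HolomorphicityRate

open scoped BigOperators Topology Manifold Classical MeasureTheory ProbabilityTheory Matrix InnerProductSpace ComplexConjugate ContinuousMap in
open Filter Set Function TopologicalSpace MeasureTheory in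
/-- **Record of the dropped route item `NonHodgeRateAtMostOne`** = stmt-HodgeConjecture-2738 (ledger signature verbatim; NOT a route
item): route HolomorphicityRate dropped the item `NonHodgeRateAtMostOne` (stmt-2738) in a later re-cut (rev 5). The declaration
`Summit.HodgeConjecture.HodgeConjecture.Theses.HolomorphicityRate.NonHodgeRateAtMostOne` therefore no longer exists in the route
file and this accepted module stopped elaborating (stale olean; buildfix lane 2026-08-19). Re-created here under its original
name so the result keeps building; the statement of every previously accepted declaration in this file is unchanged. -/
def NonHodgeRateAtMostOne : Prop :=
  ∀ (n p : ℕ) (X : Literature.AlgebraicGeometry.Motives.SchemeOver ℂ), Literature.AlgebraicGeometry.Motives.IsSmoothProjective n X → p ≤ n → ∀ (A : Literature.AlgebraicGeometry.HodgeTheory.HodgeModel n X) (g : Bundle.ContMDiffRiemannianMetric 𝓘(ℝ, A.model) ((⊤ : ℕ∞) : WithTop ℕ∞) A.model (fun x : A.carrier => TangentSpace 𝓘(ℝ, A.model) x)) (c hp : Literature.AlgebraicGeometry.HodgeTheory.complexBetti X (2 * p)) (m : ℕ) (C : ℝ) (a : ℕ → ℕ) (t : ℕ → ℝ), Literature.AlgebraicGeometry.HodgeTheory.IsRationalClass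 c → ¬ Literature.AlgebraicGeometry.HodgeTheory.IsOfHodgeType n X (2 * p) p p c → Literature.AlgebraicGeometry.HodgeTheory.IsRationalClass hp → hp ∈ Literature.AlgebraicGeometry.HodgeTheory.algebraicClasses X p → 0 < m → (∀ k, (a k : ℝ) ≤ C * (k : ℝ) ^ p) → Filter.Tendsto (fun k : ℕ => t k * (k : ℝ)) Filter.atTop (nhds 0) → ¬ (∃ᶠ k : ℕ in Filter.atTop, ∃ S Sg : Set A.carrier, (IsClosed S ∧ IsClosed Sg ∧ Sg ⊆ S ∧ IsConnected (S \ Sg) ∧ (∀ x ∈ Sg, Literature.Geometry.Kaehler.IsAnalyticSetAt 𝓘(ℂ, A.model) S x) ∧ (∃ T : Set A.carrier, Sg ⊆ T ∧ (Literature.Geometry.Kaehler.IsAnalyticSet 𝓘(ℂ, A.model) T ∧ ∀ x ∈ Literature.Geometry.Kaehler.regularLocus 𝓘(ℂ, A.model) T, ∀ q : ℕ, Literature.Geometry.Kaehler.IsRegularPointOfCodim 𝓘(ℂ, A.model) T q x → p + 1 ≤ q)) ∧ (∀ x ∈ S \ Sg, ∃ U : Set A.carrier, IsOpen U ∧ x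 ∈ U ∧ ∃ f : A.carrier → (Fin (2 * p) → ℝ), ContMDiffOn 𝓘(ℝ, A.model) 𝓘(ℝ, Fin (2 * p) → ℝ) 1 f U ∧ S ∩ U = U ∩ f ⁻¹' {0} ∧ Function.Surjective (mfderiv 𝓘(ℝ, A.model) 𝓘(ℝ, Fin (2 * p) → ℝ) f x) ∧ ∀ v : TangentSpace 𝓘(ℝ, A.model) x, mfderiv 𝓘(ℝ, A.model) 𝓘(ℝ, Fin (2 * p) → ℝ) f x v = 0 → ∃ w : TangentSpace 𝓘(ℝ, A.model) x, mfderiv 𝓘(ℝ, A.model) 𝓘(ℝ, Fin (2 * p) → ℝ) f x w = 0 ∧ g.inner x (Literature.Geometry.Kaehler.tangentJ A.model x v - w) (Literature.Geometry.Kaehler.tangentJ A.model x v - w) ≤ (t k) ^ 2 * g.inner x v v)) ∧ Literature.AlgebraicTopology.SingularHomology.singularCohomology.map ℂ ℂ (⟨Subtype.val, continuous_subtype_val⟩ : C({x : A.carrier // x ∉ S}, A.carrier)) (2 * p) (A.pullback (2 * p) (((m : ℂ) • c + ((a k : ℕ) : ℂ) • hp))) = 0)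

end Summit.HodgeConjecture.HodgeConjecture.Theses.HolomorphicityRate

namespace Summit.HodgeConjecture.HodgeConjecture.Theorems.NonHodgeRateAtMostOne.Negative

open scoped Manifold Topology
open Summit.HodgeConjecture.HodgeConjecture.Theses.HolomorphicityRate
open Literature.AlgebraicGeometry.HodgeTheory Literature.AlgebraicGeometry.Motives
open Literature.AlgebraicTopology.SingularHomology Literature.Geometry.Kaehler
open Filter

/-- **`H` = a polynomial-rate nearly holomorphic ray through a non-Hodge class.**  For some smooth
projective `X` of dimension `n`, some `p ≤ n`, an exponent `e` with `e·p > 1`, a Hodge model `A`, a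
smooth Riemannian metric `g`, a rational class `c ∈ H^{2p}(X(ℂ);ℂ)` NOT of Hodge type `(p,p)`, a
rational algebraic class `hp`, `m ≥ 1` and `C'`: for all large `j` the class `m•c + j•hp` is
supported (its pull-back to `A` dies on the complement) on a nearly holomorphic cycle support of
codimension `p` and defect `≤ C'·j^{-e}` (`Literature.Geometry.Kaehler.IsNearlyHolomorphicCycleSupport`,
whose unfolding is the route's inline representative clause verbatim,
`isNearlyHolomorphicCycleSupport_toRiemannianMetric_iff`).  Instances (module docstring): `e = 1/2`,
`3 ≤ p ≤ n - 1`, `h^{2,0}(X) ≠ 0`, `c = α•h^{p-1}`, zero sets inside a complete intersection `h^{p-1}` of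
Auroux–Donaldson asymptotically holomorphic sections [Auroux1997, Prop. 1, Cor. 1, Prop. 2;
Donaldson1996, Thm. 5, Prop. 39; VoisinHodgeI2002, Thm. 6.25].  A construction the tree cannot yet
perform (no asymptotically holomorphic theory); recorded as a definition, not asserted. -/
def NonHodgeRayAtRate : Prop :=
  ∃ (e : ℝ) (n p : ℕ) (X : SchemeOver ℂ), IsSmoothProjective n X ∧ p ≤ n ∧ 1 < e * p ∧
    ∃ (A : HodgeModel n X)
      (g : Bundle.ContMDiffRiemannianMetric 𝓘(ℝ, A.model) ((⊤ : ℕ∞) : WithTop ℕ∞) A.model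
        (fun x : A.carrier => TangentSpace 𝓘(ℝ, A.model) x))
      (c hp : complexBetti X (2 * p)) (m : ℕ) (C' : ℝ),
      IsRationalClass c ∧ ¬ IsOfHodgeType n X (2 * p) p p c ∧ IsRationalClass hp ∧
        hp ∈ algebraicClasses X p ∧ 0 < m ∧
        ∀ᶠ j : ℕ in atTop, ∃ S Sg : Set A.carrier,
          IsNearlyHolomorphicCycleSupport g.toRiemannianMetric p (C' * (j : ℝ) ^ (-e)) S Sg ∧
            singularCohomology.map ℂ ℂ
                (⟨Subtype.val, continuous_subtype_val⟩ : C({x : A.carrier // x ∉ S}, A.carrier))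
                (2 * p) (A.pullback (2 * p) (((m : ℂ) • c + ((j : ℕ) : ℂ) • hp))) = 0

/-- The elementary limit behind the reindexing: `C'·((k^p)^{-e})·k = C'·k^{1 - e p} → 0` when
`e·p > 1`. -/
theorem tendsto_const_mul_pow_rpow_neg_mul_self {e : ℝ} {p : ℕ} (hep : 1 < e * p) (C' : ℝ) :
    Tendsto (fun k : ℕ => C' * (((k ^ p : ℕ) : ℝ) ^ (-e)) * (k : ℝ)) atTop (𝓝 0) := by
  have hy : 0 < e * p - 1 := by linarith
  have h1 : Tendsto (fun k : ℕ => (k : ℝ) ^ (-(e * p - 1))) atTop (𝓝 0) :=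
    (tendsto_rpow_neg_atTop hy).comp tendsto_natCast_atTop_atTop
  have h2 : Tendsto (fun k : ℕ => C' * (k : ℝ) ^ (-(e * p - 1))) atTop (𝓝 0) := by
    simpa only [mul_zero] using h1.const_mul C'
  refine h2.congr' ?_
  filter_upwards [eventually_gt_atTop 0] with k hk
  have hk' : (0 : ℝ) < k := Nat.cast_pos.mpr hk
  have he : -(e * p - 1) = (p : ℝ) * (-e) + 1 := by ring
  rw [Nat.cast_pow, ← Real.rpow_natCast (k : ℝ) p, ← Real.rpow_mul hk'.le, mul_assoc,
    ← Real.rpow_add_one hk'.ne', he]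

/-- **Negative lemma.** `NonHodgeRayAtRate → ¬ NonHodgeRateAtMostOne`: the filed R3 is refuted by
any polynomial-rate (`e·p > 1`) nearly holomorphic ray through a non-`(p,p)` class, by passing to
the subsequence `j = k^p` — budget `a_k := k^p ≤ 1·k^p`, defects `t_k := C'·(k^p)^{-e}` with
`t_k·k → 0`, supports for all large `k` hence frequently.  With the printed rate `e = 1/2` of
Donaldson–Auroux zero sets this bites for every `3 ≤ p ≤ n - 1` on any `X` with `h^{2,0}(X) ≠ 0`
(module docstring), so the item is misstated: the threshold must scale with the budget
(`t_k·k^p → 0`, as in `ThresholdForcesHodgeType`), or the budget must be linear (`a_k ≤ C·k`). -/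
theorem NonHodgeRateAtMostOne_false_of_NonHodgeRayAtRate (hH : NonHodgeRayAtRate) :
    ¬ NonHodgeRateAtMostOne := by
  intro hR3
  obtain ⟨e, n, p, X, hX, hpn, hep, A, g, c, hp, m, C', hc, hnH, hrat, halg, hm, hev⟩ := hH
  have hp0 : p ≠ 0 := by
    rintro rfl
    norm_num at hep
  have hbud : ∀ k : ℕ, ((k ^ p : ℕ) : ℝ) ≤ 1 * (k : ℝ) ^ p :=
    fun k => le_of_eq (by rw [one_mul, Nat.cast_pow])
  refine hR3 n p X hX hpn A g c hp m 1 (fun k => k ^ p) (fun k => C' * ((k ^ p : ℕ) : ℝ) ^ (-e))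
    hc hnH hrat halg hm hbud (tendsto_const_mul_pow_rpow_neg_mul_self hep C') ?_
  exact ((tendsto_pow_atTop hp0).eventually hev).frequently

end Summit.HodgeConjecture.HodgeConjecture.Theorems.NonHodgeRateAtMostOne.Negative
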